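import Summits.ValiantsHypothesis.ValiantsHypothesis.Theorems.LacunarySymmetroidMatrixDescartesNsdPivotLoneRankOne

/-!
# `MatrixDescartes` (stmt-ValiantsHypothesis-18050) — the `2 × 2` pivot row with ANY pivot letter: a RANK-ONE LONE END LETTER
# caps the row at `2K + 1` (Descartes gives `2K + 2`), and at `2K` unless its adjugate pairs negatively with the pivot

HONEST FRAMING.  Cell `pub-symmetroid`, seat `val-sym-mdr-p2` (gen 27); helper file `--supports` the crux
`Theses.LacunarySymmetroid.MatrixDescartes` (OPEN), NO closure claim.  Third file of the day's END-LAW series (`…NsdPivotLoneRankOne`: NSD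
pivot, `2K − 1`; `…NsdPivotLoneSingular`: every size).  Here the pivot letter `J` is an ARBITRARY real `2 × 2` matrix (any index), so the
negative coefficients of `det (X^e J + ∑ X^{dₖ} Pₖ)` sit among the `K + 1` exponents `2e`, `e + dₖ` (tree `WLawTwoSignCell.neg_coeff_cases`,
`Pivot.TwoDescartes.pivotTwo_posRoots_le`: `Z₊ ≤ 2K + 2`, conjb-1's R1₂).  With ONE letter `k₀` strictly above the pivot exponent, all others
strictly below, and `det P_{k₀} = 0`, the top exponent of `det` is `e + d k₀` with coefficient `tr(adj P_{k₀} · J)` (gen 27 #1,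
`NsdLoneRankOne.coeff_det_top_eq / coeff_det_eq_zero_of_lt`), whence the DICHOTOMY:
* `tr(adj P_{k₀} · J) ≥ 0` ⇒ that exponent carries no negative coefficient ⇒ **`Z₊ ≤ 2K`** (`pivotPosRoots_le_two_mul_of_lone_above_of_nonneg`;
  this branch needs NO rank hypothesis on the lone letter);
* `tr(adj P_{k₀} · J) < 0` ⇒ the coefficient sequence ends with a negative run ⇒ `Z₊ + 1 ≤ 2K + 2`;
so in every case **`pivotPosRoots_le_two_mul_succ_of_lone_above : Z₊ ≤ 2K + 1`**, and the mirror `(1 | K−1)` statements by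
`Pivot.Reverse.pivotPosRoots_reverse`.  For a rank-one letter `P = uuᵀ` one has `adj P = u^⊥(u^⊥)ᵀ`, so the condition reads
`(u^⊥)ᵀ J u^⊥ ≥ 0`: the row can exceed `2K` on these supports only when the direction ORTHOGONAL to the lone letter lies in the negative
cone of `J`.  Relation to the tree: the lineage's `(2,K)₁` register is `[2K, 2K + 2]` (`RankOneStaircase` holds, gen 24; `…PivotStaircaseAllK`),
`= 2K` for `K ≤ 3`; val-sym-mdr-p1 g15 proved `Z₊ ≤ 9 = 2K + 1` at `K = 4` for FOUR RANK-ONE letters on every support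
(`rankOne_four_posRoots_le_nine`, where `9` can only come from the `1/3`, `3/1` splits); the present file is the all-`K` statement for
those splits with only the lone letter assumed rank one.  Whether `2K + 1` is ever attained on these supports is OPEN (at `K = 3` the
whole row is `6 = 2K`).  Nothing here bears on `MatrixDescartes` in its window, on `stub_twoSided`, on `DoorA26` / `DoorA34`, on the
cell's registers, or on `VP ≠ VNP`.

[folklore] Descartes' rule with a negative-support budget and one end (gen 27 #1) + the tree's sign-cell lemma; no definitions, no named facts.
-/

-- `Summit.ValiantsHypothesis.ValiantsHypothesis.…` repeats a component by the D-0017 layout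
-- (single-conjunct summit), which the `dupNamespace` linter flags; the name is mandated.
set_option linter.dupNamespace false

namespace Summit.ValiantsHypothesis.ValiantsHypothesis.Theorems.LacunarySymmetroidMatrixDescartes.Pivot.TwoLoneRankOne

open Matrix Finset Polynomial
open scoped BigOperators
open Pivot.TwoDescartes (letter expo pencil_eq_sum negSupp signVariations_add_le_two_mul_card_negSupp card_posRoots_le_two_mul_card)
open NsdLoneRankOne (card_posRoots_succ_le_two_mul_card coeff_det_top_eq coeff_det_eq_zero_of_lt)

variable {K : ℕ}

/-- The negative-support budget of a `2 × 2` pivot pencil with no letter at the pivot exponent: every negative coefficient of `det`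
sits at `2e` or at some `e + dₖ` (tree `WLawTwoSignCell.neg_coeff_cases`). [folklore] -/
theorem neg_coeff_mem_insert_image (e : ℕ) (d : Fin K → ℕ) (J : Matrix (Fin 2) (Fin 2) ℝ) (P : Fin K → Matrix (Fin 2) (Fin 2) ℝ)
    (hP : ∀ k, (P k).PosSemidef) (hd : ∀ k, d k ≠ e) (n : ℕ)
    (hn : (Matrix.det (((X : ℝ[X]) ^ e) • J.map Polynomial.C + ∑ k, ((X : ℝ[X]) ^ d k) • (P k).map Polynomial.C)).coeff n < 0) :
    n ∈ insert (e + e) ((Finset.univ : Finset (Fin K)).image (fun k => e + d k)) := by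
  classical
  rw [pencil_eq_sum] at hn
  rcases WLawTwoSignCell.neg_coeff_cases e d J P hP hd n hn with ⟨hne, _⟩ | ⟨k, hnk, _⟩
  · exact Finset.mem_insert.mpr (Or.inl hne)
  · exact Finset.mem_insert.mpr (Or.inr (Finset.mem_image.mpr ⟨k, Finset.mem_univ _, hnk.symm⟩))

/-- **`(K−1 | 1)`, rank-one lone upper letter, ANY pivot letter: `Z₊ ≤ 2K + 1`.**  A `2 × 2` pivot pencil `X^e J + ∑ₖ X^{dₖ} Pₖ` (`J` any
real `2 × 2` matrix, all `Pₖ ⪰ 0`) with one letter `k₀` strictly above the pivot exponent, all other letters strictly below it, and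
`det P_{k₀} = 0`, has at most `2K + 1` distinct positive determinant roots (one less than Descartes' `2K + 2`). [folklore] -/
theorem pivotPosRoots_le_two_mul_succ_of_lone_above (e : ℕ) (d : Fin K → ℕ) (J : Matrix (Fin 2) (Fin 2) ℝ)
    (P : Fin K → Matrix (Fin 2) (Fin 2) ℝ) (hP : ∀ k, (P k).PosSemidef) (k₀ : Fin K) (htop : e < d k₀)
    (hlow : ∀ k, k ≠ k₀ → d k < e) (hrk : (P k₀).det = 0) :
    pivotPosRoots e d J P ≤ 2 * K + 1 := by
  classical
  unfold pivotPosRoots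
  set F := Matrix.det (((X : ℝ[X]) ^ e) • J.map Polynomial.C + ∑ k, ((X : ℝ[X]) ^ d k) • (P k).map Polynomial.C) with hF
  set T : Finset ℕ := insert (e + e) ((Finset.univ : Finset (Fin K)).image (fun k => e + d k)) with hT
  have hTcard : T.card ≤ K + 1 :=
    (Finset.card_insert_le _ _).trans (Nat.succ_le_succ (Finset.card_image_le.trans (by simp)))
  have hd : ∀ k, d k ≠ e := by
    intro k
    by_cases hk : k = k₀
    · rw [hk]; exact htop.ne'
    · exact (hlow k hk).ne
  have hneg : ∀ n, F.coeff n < 0 → n ∈ T := fun n hn => neg_coeff_mem_insert_image e d J P hP hd n hn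
  have hn₀ : e + d k₀ ∈ T := Finset.mem_insert.mpr (Or.inr (Finset.mem_image.mpr ⟨k₀, Finset.mem_univ _, rfl⟩))
  have habove : ∀ n, e + d k₀ < n → F.coeff n = 0 := fun n hn => coeff_det_eq_zero_of_lt e d J P k₀ htop hlow hrk hn
  by_cases hsign : F.coeff (e + d k₀) ≤ 0
  · -- the last sign run is negative (or empty): budget `T` with one end
    have h := card_posRoots_succ_le_two_mul_card F T hneg hn₀ habove hsign
    omega
  · -- the top coefficient is positive: `e + d k₀` carries no negative coefficient, budget `T ∖ {e + d k₀}`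
    push Not at hsign
    have hneg' : ∀ n, F.coeff n < 0 → n ∈ T.erase (e + d k₀) := by
      intro n hn
      refine Finset.mem_erase.mpr ⟨?_, hneg n hn⟩
      rintro rfl
      exact absurd hn (not_lt.mpr hsign.le)
    have h := card_posRoots_le_two_mul_card F (T.erase (e + d k₀)) hneg'
    rw [Finset.card_erase_of_mem hn₀] at h
    omega

/-- **The good branch: `tr(adj P_{k₀} · J) ≥ 0 ⇒ Z₊ ≤ 2K`, for a lone upper letter of ANY rank.**  If the lone letter's adjugate pairs
non-negatively with the pivot (for `P_{k₀} = uuᵀ`: `(u^⊥)ᵀ J u^⊥ ≥ 0`; for full rank: `c·J₀₀ − 2b·J₀₁ + a·J₁₁ ≥ 0` with `P_{k₀} = [[a,b],[b,c]]`),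
the exponent `e + d k₀` carries no negative coefficient and the budget drops to `K` exponents. [folklore] -/
theorem pivotPosRoots_le_two_mul_of_lone_above_of_nonneg (e : ℕ) (d : Fin K → ℕ) (J : Matrix (Fin 2) (Fin 2) ℝ)
    (P : Fin K → Matrix (Fin 2) (Fin 2) ℝ) (hP : ∀ k, (P k).PosSemidef) (k₀ : Fin K) (htop : e < d k₀)
    (hlow : ∀ k, k ≠ k₀ → d k < e) (htr : 0 ≤ ((P k₀).adjugate * J).trace) :
    pivotPosRoots e d J P ≤ 2 * K := by
  classical
  unfold pivotPosRoots
  set F := Matrix.det (((X : ℝ[X]) ^ e) • J.map Polynomial.C + ∑ k, ((X : ℝ[X]) ^ d k) • (P k).map Polynomial.C) with hF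
  set T : Finset ℕ := insert (e + e) ((Finset.univ : Finset (Fin K)).image (fun k => e + d k)) with hT
  have hTcard : T.card ≤ K + 1 :=
    (Finset.card_insert_le _ _).trans (Nat.succ_le_succ (Finset.card_image_le.trans (by simp)))
  have hd : ∀ k, d k ≠ e := by
    intro k
    by_cases hk : k = k₀
    · rw [hk]; exact htop.ne'
    · exact (hlow k hk).ne
  have hn₀ : e + d k₀ ∈ T := Finset.mem_insert.mpr (Or.inr (Finset.mem_image.mpr ⟨k₀, Finset.mem_univ _, rfl⟩))
  have htopc : 0 ≤ F.coeff (e + d k₀) := by rw [hF, coeff_det_top_eq e d J P k₀ htop hlow]; exact htr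
  have hneg' : ∀ n, F.coeff n < 0 → n ∈ T.erase (e + d k₀) := by
    intro n hn
    refine Finset.mem_erase.mpr ⟨?_, neg_coeff_mem_insert_image e d J P hP hd n hn⟩
    rintro rfl
    exact absurd hn (not_lt.mpr htopc)
  have h := card_posRoots_le_two_mul_card F (T.erase (e + d k₀)) hneg'
  rw [Finset.card_erase_of_mem hn₀] at h
  omega

/-- **`(1 | K−1)`, rank-one lone LOWER letter, any pivot letter: `Z₊ ≤ 2K + 1`** (mirror under `x ↦ 1/x`). [folklore] -/
theorem pivotPosRoots_le_two_mul_succ_of_lone_below (e : ℕ) (d : Fin K → ℕ) (J : Matrix (Fin 2) (Fin 2) ℝ)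
    (P : Fin K → Matrix (Fin 2) (Fin 2) ℝ) (hP : ∀ k, (P k).PosSemidef) (k₀ : Fin K) (hbot : d k₀ < e)
    (hup : ∀ k, k ≠ k₀ → e < d k) (hrk : (P k₀).det = 0) :
    pivotPosRoots e d J P ≤ 2 * K + 1 := by
  classical
  set N : ℕ := e + ∑ k, d k with hN
  have he : e ≤ N := by rw [hN]; exact Nat.le_add_right _ _
  have hdN : ∀ k, d k ≤ N := fun k => by
    rw [hN]
    exact (Finset.single_le_sum (fun i _ => Nat.zero_le (d i)) (Finset.mem_univ k)).trans (Nat.le_add_left _ _)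
  rw [← Reverse.pivotPosRoots_reverse N e d J P he hdN]
  refine pivotPosRoots_le_two_mul_succ_of_lone_above (N - e) (fun k => N - d k) J P hP k₀ ?_ ?_ hrk
  · have := hdN k₀; omega
  · intro k hk
    have := hup k hk; have := hdN k; omega

/-- **`(1 | K−1)`, good branch**: lone lower letter (any rank) with `tr(adj P_{k₀} · J) ≥ 0` ⇒ `Z₊ ≤ 2K`. [folklore] -/
theorem pivotPosRoots_le_two_mul_of_lone_below_of_nonneg (e : ℕ) (d : Fin K → ℕ) (J : Matrix (Fin 2) (Fin 2) ℝ)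
    (P : Fin K → Matrix (Fin 2) (Fin 2) ℝ) (hP : ∀ k, (P k).PosSemidef) (k₀ : Fin K) (hbot : d k₀ < e)
    (hup : ∀ k, k ≠ k₀ → e < d k) (htr : 0 ≤ ((P k₀).adjugate * J).trace) :
    pivotPosRoots e d J P ≤ 2 * K := by
  classical
  set N : ℕ := e + ∑ k, d k with hN
  have he : e ≤ N := by rw [hN]; exact Nat.le_add_right _ _
  have hdN : ∀ k, d k ≤ N := fun k => by
    rw [hN]
    exact (Finset.single_le_sum (fun i _ => Nat.zero_le (d i)) (Finset.mem_univ k)).trans (Nat.le_add_left _ _)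
  rw [← Reverse.pivotPosRoots_reverse N e d J P he hdN]
  refine pivotPosRoots_le_two_mul_of_lone_above_of_nonneg (N - e) (fun k => N - d k) J P hP k₀ ?_ ?_ htr
  · have := hdN k₀; omega
  · intro k hk
    have := hup k hk; have := hdN k; omega

/-- **For a rank-one letter `uuᵀ` the pairing is the quadratic form of `J` at the orthogonal direction**:
`tr(adj(uuᵀ) · J) = (u^⊥)ᵀ J u^⊥` with `u^⊥ = (−u₁, u₀)` — so the good branch `≥ 0` fails only when `u^⊥` lies in the negative cone of
`J`. [folklore] -/
theorem trace_adjugate_vecMulVec_mul (u : Fin 2 → ℝ) (J : Matrix (Fin 2) (Fin 2) ℝ) :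
    ((Matrix.vecMulVec u u).adjugate * J).trace = ![-u 1, u 0] ⬝ᵥ (J *ᵥ ![-u 1, u 0]) := by
  rw [Matrix.adjugate_fin_two, Matrix.trace_fin_two]
  simp [Matrix.mul_apply, Fin.sum_univ_two, Matrix.vecMulVec_apply, Matrix.mulVec, dotProduct]
  ring

end Summit.ValiantsHypothesis.ValiantsHypothesis.Theorems.LacunarySymmetroidMatrixDescartes.Pivot.TwoLoneRankOne
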